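import Mathlib
import HarnessLib
import Summits.KontsevichZagierPeriods.Zeta5Search.TwoTaleP15LineBoundDecay
import Summits.KontsevichZagierPeriods.Zeta5Search.Denom.TwoTaleP15LineCertificate

/-!
# `Decay c` holds at P15 for every `c < 29.1078708` (P15 kernel, task E5 closed)

HONEST FRAMING: systematic search; no irrationality claim unless certified.  This file proves the
DECAY INPUT `Denom.TwoTaleP15Forms.Decay c` of the two-tale ζ(2) chain at the point P15 for every
`c < 29.1078708` — i.e. `|qₙ ζ(2) − pₙ| ≤ e^{−cn}` eventually for the explicit Zudilin forms of
`Denom/TwoTaleP15Forms.lean`.  It says NOTHING about irrationality measures by itself (the other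
inputs of the chain are separate items) and nothing about `ζ(5)`.

Assembly of three tree results:
* P1 g9's reduction `TwoTaleLineBound.decay_of_certificate` (`TwoTaleP15LineBoundDecay.lean`):
  `0 < δ → (∀ η ≠ 0, rateG η − (2π − δ)|η| ≤ M) → c < −M → Decay c`;
* the kernel-checked one-variable certificate `TwoTaleP15LineCertificate.profile_le`:
  `profile (26/5) η ≤ −29.1078708` (`η ≠ 0`), where `profile = profile0 − 2π|η|`;
* the identification `rateG = profile0 (26/5)` (`rateG_eq`, definitional bookkeeping) and the
  `δ`-slack from concavity: for `η ≥ 13` the slope `D15 η ≤ −4` (`D15_le_neg_four`), so by the mean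
  value theorem `P15 η ≤ P15 13 − 4(η − 13)` (`P15_tail`), whence
  `rateG η − (2π − δ)|η| ≤ −29.1078708 + 13δ` for `0 ≤ δ ≤ 4` (`cert_delta`).
Main results: `decay_of_lt (hc : c < 29.1078708) : Decay c`, `decay_holds : Decay 29.10`,
`decay_holds_sharp : Decay 29.10787`.  Cell record: `families/denom/P15KERNEL.md` §8.
-/

noncomputable section

open Real Set

namespace Summit.KontsevichZagierPeriods.Zeta5Search.Denom.TwoTaleP15DecayHolds

open Summit.KontsevichZagierPeriods.Zeta5Search.Denom.LineProfile
open Summit.KontsevichZagierPeriods.Zeta5Search.Denom.LineProfileShape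
open Summit.KontsevichZagierPeriods.Zeta5Search.Denom.TwoTaleP15LineCertificate
open Summit.KontsevichZagierPeriods.Zeta5Search.TwoTaleLineBound (rateG prim kappaP15
  decay_of_certificate)

/-! ## The two normalisations agree -/

/-- P1 g9's primitive `prim` is fam-denom's `gPrim`. -/
theorem prim_eq_gPrim (η V : ℝ) : prim η V = gPrim η V := by
  unfold prim gPrim
  ring

/-- P1 g9's rate function is fam-denom's `profile0 (26/5)`. -/
theorem rateG_eq (η : ℝ) : rateG η = profile0 (26 / 5) η := by
  simp only [rateG, kappaP15, profile0, profileConst, prim_eq_gPrim]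
  norm_num
  ring

/-! ## The `δ`-slack from concavity -/

/-- For `η ≥ 13` the slope of the profile is at most `−4`
(`numLegs ≤ 27/13`, `denAngle ≥ 0`, `2π > 6.28`). -/
theorem D15_le_neg_four {η : ℝ} (hη : 13 ≤ η) : D15 η ≤ -4 := by
  rw [D15_eq]
  have hη0 : 0 < η := by linarith
  have hden : 0 ≤ denAngle η := by
    unfold denAngle
    have : Real.arctan (46 / 5 / η) ≤ Real.arctan (101 / 5 / η) :=
      Real.arctan_mono (div_le_div_of_nonneg_right (by norm_num) hη0.le)
    linarith
  have leg : ∀ c : ℝ, 0 ≤ c → Real.arctan (c / η) ≤ c / 13 := fun c hc =>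
    (show Real.arctan (c / η) ≤ c / η from by
      have ht : (0 : ℝ) ≤ c / η := div_nonneg hc hη0.le
      have h0 : 0 ≤ Real.arctan (c / η) := by simpa using Real.arctan_mono ht
      have h := Real.le_tan h0 (Real.arctan_lt_pi_div_two _)
      rwa [Real.tan_arctan] at h).trans
      (div_le_div_of_nonneg_left hc (by norm_num) hη)
  have l1 := leg (36 / 5) (by norm_num)
  have l2 := leg (29 / 5) (by norm_num)
  have l3 := leg (26 / 5) (by norm_num)
  have l4 := leg (19 / 5) (by norm_num)
  have l5 := leg (16 / 5) (by norm_num)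
  have l6 := leg (9 / 5) (by norm_num)
  unfold numLegs
  linarith [Real.pi_gt_d2]

/-- Tail bound from the mean value theorem: `P15 η ≤ P15 13 − 4 (η − 13)` for `η ≥ 13`. -/
theorem P15_tail {η : ℝ} (hη : 13 ≤ η) : P15 η ≤ P15 13 - 4 * (η - 13) := by
  rcases hη.eq_or_lt with h | hlt
  · rw [← h]
    simp
  have cont : ContinuousOn P15 (Icc 13 η) :=
    (continuousOn_profile (26 / 5)).mono fun x hx => lt_of_lt_of_le (by norm_num) hx.1
  have deriv : ∀ x ∈ Ioo 13 η, HasDerivAt P15 (D15 x) x := fun x hx =>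
    hasDerivAt_P15 (lt_trans (by norm_num) hx.1)
  obtain ⟨ξ, hξ, hslope⟩ := exists_hasDerivAt_eq_slope P15 D15 hlt cont deriv
  have h4 : D15 ξ ≤ -4 := D15_le_neg_four hξ.1.le
  rw [hslope, div_le_iff₀ (by linarith)] at h4
  linarith

/-- The certificate with slack on `η > 0`:
`profile0 (26/5) η − (2π − δ) η ≤ −29.1078708 + 13 δ` for `0 ≤ δ ≤ 4`. -/
theorem cert_of_pos {δ : ℝ} (hδ0 : 0 ≤ δ) (hδ4 : δ ≤ 4) {η : ℝ} (hη : 0 < η) :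
    profile0 (26 / 5) η - (2 * π - δ) * η ≤ -29.1078708 + 13 * δ := by
  have hP : profile0 (26 / 5) η - (2 * π - δ) * η = P15 η + δ * η := by
    simp only [P15, profile, abs_of_pos hη]
    ring
  rw [hP]
  rcases le_or_gt η 13 with h13 | h13
  · have h1 : P15 η ≤ -29.1078708 := profile_le_of_pos hη
    nlinarith
  · have ht := P15_tail h13.le
    have h13v : P15 13 ≤ -29.1078708 := profile_le_of_pos (by norm_num)
    nlinarith

/-- **The `δ`-certificate** in P1 g9's normalisation: for `0 ≤ δ ≤ 4` and every `η ≠ 0`,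
`rateG η − (2π − δ)|η| ≤ −29.1078708 + 13 δ`. -/
theorem cert_delta {δ : ℝ} (hδ0 : 0 ≤ δ) (hδ4 : δ ≤ 4) (η : ℝ) (hη : η ≠ 0) :
    rateG η - (2 * π - δ) * |η| ≤ -29.1078708 + 13 * δ := by
  rw [rateG_eq]
  rcases lt_or_gt_of_ne hη with h | h
  · have h' : 0 < -η := by linarith
    have hc := cert_of_pos hδ0 hδ4 h'
    rw [profile0_neg_eta] at hc
    rw [abs_of_neg h]
    linarith
  · rw [abs_of_pos h]
    exact cert_of_pos hδ0 hδ4 h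

/-! ## Decay -/

/-- **`Decay c` for every `c < 29.1078708`** (P15; `|qₙ ζ(2) − pₙ| ≤ e^{−cn}` eventually). -/
theorem decay_of_lt {c : ℝ} (hc : c < 29.1078708) : TwoTaleP15Forms.Decay c := by
  have hδ0 : 0 < min 4 ((29.1078708 - c) / 26) := lt_min (by norm_num) (by linarith)
  have hδ4 : min 4 ((29.1078708 - c) / 26) ≤ 4 := min_le_left _ _
  have hδc : min 4 ((29.1078708 - c) / 26) ≤ (29.1078708 - c) / 26 := min_le_right _ _
  exact decay_of_certificate hδ0 (fun η hη => cert_delta hδ0.le hδ4 η hη) (by linarith)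

/-- **`Decay 29.10`** (the constant used in the cell record `P15KERNEL.md` §8). -/
theorem decay_holds : TwoTaleP15Forms.Decay 29.10 := decay_of_lt (by norm_num)

/-- **`Decay 29.10787`** (five digits of the model value `C₀(P15) = 29.10787127…`). -/
theorem decay_holds_sharp : TwoTaleP15Forms.Decay 29.10787 := decay_of_lt (by norm_num)

end Summit.KontsevichZagierPeriods.Zeta5Search.Denom.TwoTaleP15DecayHolds

end
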